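import Literature.MathematicalPhysics.QuantumFieldTheory.QCDThermalPartition
import Literature.MathematicalPhysics.QuantumLattice.ThermalLatticeGauge
import Literature.MathematicalPhysics.QuantumLattice.GrassmannIntegralWilsonProofs
import Literature.MathematicalPhysics.QuantumLattice.GrassmannIntegralProofs
import HarnessLib

/-!
# The thermal Wilson determinant of lattice QCD on `ℤ_{N_t} × (ℤ/N_s)³`: structure, γ₅-hermiticity,
# reality, and positivity of `Z` for positive bare masses

Follow-up to the definition request `defn-qcdThermalPartition` (route `CounterexampleMustBeHot` of
`Summits/QuantumFields/QCD`, shared with `CentreStabilisedCircle`, `FemtoStepScaling`): the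
notion itself — `qcdThermalPartition Nf Nt Ns β mq`, the Berezin–Haar partition function of
Wilson's `SU(3)` action with `N_f` time-ANTIPERIODIC `r = 1` Wilson quarks, and
`thermalFreeEnergyDensity = −log ‖Z‖/(N_t N_s³)` — lives in
`Literature.MathematicalPhysics.QuantumFieldTheory.QCDThermalPartition`. This file supplies the
PROVED structure theory of its integrand, the thermal Wilson determinant `det D(U)`, that the
requesting routes need in order to read `Z` as a positive number and `f` as `−ln Z/(N_t N_s³)`.

## Contents (everything is a definition with a body or a theorem; no named fact)

* **Host bridge** (cone repair): the barrier-free `SlabGauge.*` vocabulary on which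
  `qcdThermalPartition` is typed agrees with the clean-cone host
  `Literature.MathematicalPhysics.QuantumLattice.FiniteTemperature.*` of `ThermalLatticeGauge.lean`
  (`SlabGauge.shift_eq_host/plaquette_eq_host/minusAction_eq_host/weight_eq_host/haar_eq_host`),
  hence `qcdThermalPartition_eq_host`: `Z` IS the same Berezin–Haar integral typed over the host —
  thermal routes may state their items over `FiniteTemperature.{Config, haar, weight}` after
  `open Literature.MathematicalPhysics.QuantumLattice` without importing any barrier file.
* **Structure** (Montvay–Münster (4.85)/(5.5)): `qcdThermalDirac U mq` is the enumeration of
  `Λ − ½ Σ_μ H_μ` (`qcdThermalDirac_eq_reindex_thermalDiracCore`), with the mass term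
  `Λ = thermalMassMatrix mq = diag(m_f + 4)` and the four **unit hopping matrices**
  `H_μ = thermalHopping U μ = 1_flavour ⊗ (V_μ ⊗ (1 − γ_k) + V_μ† ⊗ (1 + γ_k))`, where
  `V_μ = thermalLinkHop U μ` is the signed (antiperiodic seam sign) link hopping matrix on
  site × colour — a signed permutation times the unitary link variables, hence unitary
  (`thermalLinkHop_mul_conjTranspose`). The one-parameter family
  `thermalDiracCore U mq t = Λ − (t/2) Σ_μ H_μ` interpolates the hopping parameter linearly
  (`K = t/(2m + 8)`, Montvay–Münster (4.87)) from `0` to its value at `t = 1`.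
* **γ₅-hermiticity** (Montvay–Münster (5.15) "`Q_{yx} = γ₅ Q†_{xy} γ₅`", printed for the periodic
  operator; the antiperiodic seam signs are real and sit on both hops through the seam link, so
  the book's two-line argument applies verbatim): `qcdThermalDirac_conjTranspose`,
  `D† = γ₅ D γ₅` with `γ₅ = thermalGammaFive` (`1 ⊗ 1 ⊗ γ₅`, chiral basis), for the whole family
  (`conjTranspose_thermalDiracCore`); proved by Kronecker algebra from `γ₅ (1 ∓ γ_k) γ₅ = 1 ± γ_k`.
* **Reality** (Montvay–Münster (5.16) "the quark determinant is real"): `det_qcdThermalDirac_im`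
  (`Im det D(U) = 0` for every gauge field, all real masses, every `N_f`), hence
  `qcdThermalPartition_eq_ofReal_integral` (`Z = ∫ Re det D · e^{β Σ Re tr U_P} ∏dU` as a real
  Haar integral), `qcdThermalPartition_im` (`Im Z = 0`) and
  `thermalFreeEnergyDensity_eq_neg_log_abs_re` (`f = −log |Re Z|/(N_t N_s³)`).
* **Positivity for positive bare masses** (`m_f > 0` for all `f`, i.e. hopping parameters
  `K_f = 1/(2m_f + 8) < 1/8`, Montvay–Münster (4.87); `1/8` is the free critical value (4.125)):
  `‖H_μ x‖² = 4‖x‖²` (`normSq_thermalHopping_mulVec`, from `H_μ† H_μ = 4`), so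
  `‖(t/2) Σ_μ H_μ x‖ ≤ 4‖x‖ < min_f (m_f + 4)‖x‖ ≤ ‖Λx‖` and `Λ − (t/2)Σ H_μ` has no kernel for
  `t ∈ [0, 1]` (`eq_zero_of_thermalDiracCore_mulVec_eq_zero`, `det_thermalDiracCore_ne_zero`);
  the determinant is real along the homotopy and equals `∏ (m_f + 4) > 0` at `t = 0`, so by the
  intermediate value theorem **`det D(U) > 0` for EVERY gauge field** (`det_qcdThermalDirac_re_pos`).
  Consequently `qcdThermalPartition_re_pos` / `qcdThermalPartition_pos` / `_ne_zero`:
  **`Z` is a positive real number for all `β ∈ ℝ`, all `N_t, N_s ≥ 1`, every `N_f`, whenever all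
  `m_f > 0`**, and `thermalFreeEnergyDensity_eq_neg_log_re`: `f = −ln Z/(N_t N_s³)` with the genuine
  logarithm (Montvay–Münster (5.246) at `a = 1`). This covers the heavy-quark corner of the
  routes (`StrongCouplingAnchor`: `m_f ≥ M` large) unconditionally and for either sign of `β`.

## Not here

* **Lüscher positivity on the physical branch `m_f > −1` (`K_f < 1/6`)**: for `β ≥ 0` the
  functional integral with time-antiperiodic `r = 1` Wilson quarks is the trace `Tr 𝕋^{N_t}` of
  a bounded self-adjoint strictly positive transfer operator on the gauge-invariant subspace
  (Lüscher, Commun. Math. Phys. 54 (1977) 283; Montvay–Münster §4.2.3 (4.111) "the matrix `B`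
  is positive for every `|K| < 1/6`", §4.1.3 (4.34) "antiperiodicity in time", §5.1.1 p. 226
  "Reflection positivity of the Wilson action (5.4) can be proven similarly"), hence `Z > 0`
  there too. In that range `det D(U)` is NOT pointwise positive (cf. the barrier
  `Literature.Barriers.QuantumFields.WilsonDeterminantSign`), so the argument of this file does
  not extend; the transfer-matrix proof needs the fermionic Fock-space trace formula for the
  gauged, time-dependent quadratic form and is not formalised here. The primary source is not
  held (acquisition request acq-00010); no unproved named fact is introduced for it (D-0026).
* Thermal expectations and their reflection positivity (`qcdCircleExpect` of
  `QCDSlabFunctional.lean` at twist `θ ≡ π`), the identification with `qcdSlabPartition` /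
  `qcdTorusExpectAP` up to relabelling — see the "Not here" list of `QCDThermalPartition.lean`.

## References (held copy of Montvay–Münster read, PDF page = book page)

* I. Montvay, G. Münster, *Quantum Fields on a Lattice* (CUP 1994): §4.2.2 (4.85)–(4.89)
  (p. 179: Wilson action, `K = 1/(2am + 8r)`), §4.2.3 (4.111) (p. 184), §4.2.4 (4.112)–(4.115)
  (p. 185: antiperiodic sign factors), (4.125) (p. 187: `K_cr = 1/(8r)` free), §5.1.1 (5.5)
  (p. 225), §5.1.2 (5.12)–(5.19) (pp. 228–229: `det Q` real by `Q_{yx} = γ₅ Q†_{xy} γ₅`),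
  §5.4.1 (5.246) (p. 292), App. 8.1.2 (8.5)–(8.10) (`γ` matrices). [MontvayMunster1994]
* M. Lüscher, Commun. Math. Phys. 54 (1977) 283–292 (scope remark only). [Luscher1977]
* C. Borgs, E. Seiler, Commun. Math. Phys. 91 (1983) 329, §II.3 (II.20) (the lattice
  `ℤ_{L₀} × Λ_s`). [BorgsSeiler1983]
-/

noncomputable section

open MeasureTheory Matrix Complex
open scoped Kronecker
open Literature.MathematicalPhysics.QuantumLattice

namespace Literature.MathematicalPhysics.QuantumFieldTheory

/-! ### Host bridge: `SlabGauge.*` versus the clean-cone host `QuantumLattice.FiniteTemperature.*`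

The two vocabularies have the same bodies, so the identifications below hold by `rfl`
(definitional unfolding). -/

namespace SlabGauge

variable {d L₀ L : ℕ} {G : Type*}

/-- The two copies of the neighbour map agree. [folklore] -/
theorem shift_eq_host (x : Site d L₀ L) (μ : Dir d) :
    x.shift μ = FiniteTemperature.Site.shift x μ := by
  cases μ <;> rfl

variable [Group G] {N : ℕ} (ρ : G →* Matrix (Fin N) (Fin N) ℂ)

/-- The two copies of the plaquette holonomy agree. [folklore] -/
theorem plaquette_eq_host (U : Config d L₀ L G) (x : Site d L₀ L) (μ ν : Dir d) :
    plaquette U x μ ν = FiniteTemperature.plaquette U x μ ν := rfl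

/-- The two copies of minus the Wilson action agree. [folklore] -/
theorem minusAction_eq_host [NeZero L₀] [NeZero L] (JE JM : ℝ) (U : Config d L₀ L G) :
    minusAction ρ JE JM U = FiniteTemperature.minusAction ρ JE JM U := rfl

/-- The two copies of the Boltzmann weight agree. [folklore] -/
theorem weight_eq_host [NeZero L₀] [NeZero L] (JE JM : ℝ) (U : Config d L₀ L G) :
    weight ρ JE JM U = FiniteTemperature.weight ρ JE JM U := rfl

/-- The two copies of the product Haar measure agree. [folklore] -/
theorem haar_eq_host [NeZero L₀] [NeZero L] [TopologicalSpace G] [IsTopologicalGroup G]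
    [CompactSpace G] [MeasurableSpace G] [BorelSpace G] :
    haar d L₀ L G = FiniteTemperature.haar d L₀ L G := rfl

end SlabGauge

variable {Nf Nt Ns : ℕ}

/-- **The thermal partition function over the clean-cone host vocabulary.** [folklore] -/
theorem qcdThermalPartition_eq_host (Nf Nt Ns : ℕ) [NeZero Nt] [NeZero Ns] (β : ℝ)
    (mq : Fin Nf → ℝ) :
    qcdThermalPartition Nf Nt Ns β mq =
      ∫ U, GrassmannAlgebra.berezin ℂ _ (grassmannExp (quadratic ℂ (-qcdThermalDirac U mq))) *
          ((FiniteTemperature.weight (fundamentalRep (Fin 3)) β β U : ℝ) : ℂ)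
        ∂(FiniteTemperature.haar 3 Nt Ns (Matrix.specialUnitaryGroup (Fin 3) ℂ)) := rfl


/-! ### Spin algebra of the Wilson projectors `1 ∓ γ_k` and of `γ₅` -/

/-- The Wilson "projector" `1 − γ_k` (twice the orthogonal projection `P⁻_k`). [folklore] -/
abbrev oneSubGamma (k : Fin 4) : Matrix (Fin 4) (Fin 4) ℂ := 1 - euclideanGamma k

/-- The Wilson "projector" `1 + γ_k` (twice the orthogonal projection `P⁺_k`). [folklore] -/
abbrev oneAddGamma (k : Fin 4) : Matrix (Fin 4) (Fin 4) ℂ := 1 + euclideanGamma k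

/-- `γ_k† = γ_k` (Montvay–Münster App. 8.1.2 (8.5)). [cite: MontvayMunster1994, App. 8.1.2 (8.5)] -/
theorem conjTranspose_euclideanGamma (k : Fin 4) : (euclideanGamma k)ᴴ = euclideanGamma k :=
  (euclideanGamma_isHermitian k).eq

/-- `(1 − γ_k)† = 1 − γ_k`. [folklore] -/
theorem conjTranspose_oneSubGamma (k : Fin 4) : (oneSubGamma k)ᴴ = oneSubGamma k := by
  rw [oneSubGamma, conjTranspose_sub, conjTranspose_one, conjTranspose_euclideanGamma]

/-- `(1 + γ_k)† = 1 + γ_k`. [folklore] -/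
theorem conjTranspose_oneAddGamma (k : Fin 4) : (oneAddGamma k)ᴴ = oneAddGamma k := by
  rw [oneAddGamma, conjTranspose_add, conjTranspose_one, conjTranspose_euclideanGamma]

/-- `(1 − γ_k)² = 2(1 − γ_k)` (`γ_k² = 1`). [folklore] -/
theorem oneSubGamma_mul_oneSubGamma (k : Fin 4) :
    oneSubGamma k * oneSubGamma k = (2 : ℂ) • oneSubGamma k := by
  simp only [oneSubGamma, sub_mul, mul_sub, one_mul, mul_one, euclideanGamma_mul_self, two_smul]
  abel

/-- `(1 + γ_k)² = 2(1 + γ_k)`. [folklore] -/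
theorem oneAddGamma_mul_oneAddGamma (k : Fin 4) :
    oneAddGamma k * oneAddGamma k = (2 : ℂ) • oneAddGamma k := by
  simp only [oneAddGamma, add_mul, mul_add, one_mul, mul_one, euclideanGamma_mul_self, two_smul]
  abel

/-- `(1 − γ_k)(1 + γ_k) = 0`. [folklore] -/
theorem oneSubGamma_mul_oneAddGamma (k : Fin 4) : oneSubGamma k * oneAddGamma k = 0 := by
  simp only [oneSubGamma, oneAddGamma, sub_mul, mul_add, one_mul, mul_one, euclideanGamma_mul_self]
  abel

/-- `(1 + γ_k)(1 − γ_k) = 0`. [folklore] -/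
theorem oneAddGamma_mul_oneSubGamma (k : Fin 4) : oneAddGamma k * oneSubGamma k = 0 := by
  simp only [oneSubGamma, oneAddGamma, add_mul, mul_sub, one_mul, mul_one, euclideanGamma_mul_self]
  abel

/-- `(1 − γ_k) + (1 + γ_k) = 2`. [folklore] -/
theorem oneSubGamma_add_oneAddGamma (k : Fin 4) :
    oneSubGamma k + oneAddGamma k = (2 : ℂ) • 1 := by
  simp only [oneSubGamma, oneAddGamma, two_smul]
  abel

/-- `γ₅² = 1`. (Deliberate twin of `Literature.MathematicalPhysics.QuantumLattice.gammaFive_mul_self`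
of `SpectralLocalizer.lean`, re-proved in three lines here because that module imports
`TopologicalCriticalMass` and thereby the barrier file `WilsonDeterminantSign` — importing it
would put an unproved barrier fact back into the thermal routes' cone, which this file exists to
keep clean.) [folklore] -/
theorem gammaFive_mul_gammaFive : gammaFive * gammaFive = 1 := by
  rw [gammaFive_eq_diagonal, diagonal_mul_diagonal, ← diagonal_one]
  congr 1
  funext α
  exact gammaFiveSign_mul_self α

/-- `γ₅ᴴ = γ₅`. [folklore] -/
theorem conjTranspose_gammaFive : gammaFiveᴴ = gammaFive := by
  rw [gammaFive_eq_diagonal, diagonal_conjTranspose]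
  congr 1
  funext α
  fin_cases α <;> simp

/-- `γ₅ γ_k γ₅ = −γ_k`. [folklore] -/
theorem gammaFive_mul_euclideanGamma_mul_gammaFive (k : Fin 4) :
    gammaFive * euclideanGamma k * gammaFive = -euclideanGamma k := by
  rw [gammaFive_eq_diagonal]
  ext α β
  rw [mul_diagonal, diagonal_mul, neg_apply]
  exact gammaFiveSign_mul_euclideanGamma_mul_gammaFiveSign k α β

/-- `γ₅ (1 − γ_k) γ₅ = 1 + γ_k`. [folklore] -/
theorem gammaFive_mul_oneSubGamma_mul_gammaFive (k : Fin 4) :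
    gammaFive * oneSubGamma k * gammaFive = oneAddGamma k := by
  rw [oneSubGamma, oneAddGamma, mul_sub, sub_mul, mul_one, gammaFive_mul_gammaFive,
    gammaFive_mul_euclideanGamma_mul_gammaFive, sub_neg_eq_add]

/-- `γ₅ (1 + γ_k) γ₅ = 1 − γ_k`. [folklore] -/
theorem gammaFive_mul_oneAddGamma_mul_gammaFive (k : Fin 4) :
    gammaFive * oneAddGamma k * gammaFive = oneSubGamma k := by
  rw [oneSubGamma, oneAddGamma, mul_add, add_mul, mul_one, gammaFive_mul_gammaFive,
    gammaFive_mul_euclideanGamma_mul_gammaFive, ← sub_eq_add_neg]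


/-! ### The structure of the thermal Wilson–Dirac matrix: mass term and unit hopping matrices -/

section Reindex

variable {m n : Type*}

/-- Enumerations commute with products. [folklore] -/
theorem reindex_mul_reindex [Fintype m] [Fintype n] (e : m ≃ n) (A B : Matrix m m ℂ) :
    reindex e e A * reindex e e B = reindex e e (A * B) := by
  simp only [reindex_apply, submatrix_mul_equiv]

/-- Enumerations commute with scalars. [folklore] -/
theorem reindex_smul_eq (e : m ≃ n) (c : ℂ) (A : Matrix m m ℂ) :
    reindex e e (c • A) = c • reindex e e A := rfl

/-- Enumerations preserve the identity. [folklore] -/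
theorem reindex_one_eq [DecidableEq m] [DecidableEq n] (e : m ≃ n) :
    reindex e e (1 : Matrix m m ℂ) = 1 := by
  simp only [reindex_apply, submatrix_one_equiv]

end Reindex

namespace SlabGauge

/-- The neighbour map `x ↦ x + e_μ` is injective. [folklore] -/
theorem shift_injective {d L₀ L : ℕ} (μ : Dir d) :
    Function.Injective fun x : Site d L₀ L => x.shift μ := by
  intro x y h
  cases μ with
  | none =>
    simp only [Site.shift, Prod.mk.injEq, add_left_inj] at h
    exact Prod.ext h.1 h.2
  | some i =>
    simp only [Site.shift, Prod.mk.injEq, add_left_inj] at h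
    exact Prod.ext h.1 h.2

end SlabGauge

/-- The seam sign is real. [folklore] -/
@[simp] theorem star_thermalSeamSign (μ : SlabGauge.Dir 3) (x : SlabGauge.Site 3 Nt Ns) :
    star (thermalSeamSign μ x) = thermalSeamSign μ x := by
  unfold thermalSeamSign
  split_ifs <;> simp

/-- The seam sign squares to one. [folklore] -/
@[simp] theorem thermalSeamSign_mul_self (μ : SlabGauge.Dir 3) (x : SlabGauge.Site 3 Nt Ns) :
    thermalSeamSign μ x * thermalSeamSign μ x = 1 := by
  unfold thermalSeamSign
  split_ifs <;> norm_num

section Structure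

variable [NeZero Nt] [NeZero Ns]

/-- The **signed link hopping matrix** `V_μ` on (site × colour): the entry `((x, a), (y, b))` is
`s_μ(x) U(x, μ)_{ab}` if `y = x + μ̂` and `0` otherwise (`s_μ = thermalSeamSign μ` the antiperiodic
seam sign) — a signed permutation of the sites times the unitary link matrices, hence unitary
(`thermalLinkHop_mul_conjTranspose`). [folklore] -/
def thermalLinkHop (U : QCDCircleConfig Nt Ns) (μ : SlabGauge.Dir 3) :
    Matrix (SlabGauge.Site 3 Nt Ns × Fin 3) (SlabGauge.Site 3 Nt Ns × Fin 3) ℂ :=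
  Matrix.of fun p q =>
    if q.1 = p.1.shift μ then thermalSeamSign μ p.1 * fundamentalRep (Fin 3) (U (p.1, μ)) p.2 q.2
    else 0

/-- The **unit hopping matrix** `H_μ` in direction `μ` on the quark variables
(flavour × (site × (colour × spin))):
`H_μ = 1_flavour ⊗ (V_μ ⊗ (1 − γ_k) + V_μ† ⊗ (1 + γ_k))`, `V_μ = thermalLinkHop U μ`,
`k = μ.elim 3 Fin.castSucc` the `γ`-matrix axis of `μ`; entrywise (`thermalHopping_apply`) the
forward hop `s_μ(x) (1 − γ_k)_{αβ} U(x,μ)_{ab} δ_{y,x+μ̂}` plus the backward hop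
`s_μ(y) (1 + γ_k)_{αβ} (U(y,μ)⁻¹)_{ab} δ_{x,y+μ̂}` of the Wilson–Dirac matrix (Montvay–Münster
(4.85)/(5.5), `r = 1`) without the prefactor `−½`. [cite: MontvayMunster1994, §4.2.2 (4.85); §5.1.1 (5.5)] -/
def thermalHopping (U : QCDCircleConfig Nt Ns) (μ : SlabGauge.Dir 3) :
    Matrix (CircleQuarkVar Nf Nt Ns) (CircleQuarkVar Nf Nt Ns) ℂ :=
  (1 : Matrix (Fin Nf) (Fin Nf) ℂ) ⊗ₖ
    Matrix.reindex (Equiv.prodAssoc _ _ _) (Equiv.prodAssoc _ _ _)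
      (thermalLinkHop U μ ⊗ₖ oneSubGamma (μ.elim 3 Fin.castSucc) +
        (thermalLinkHop U μ)ᴴ ⊗ₖ oneAddGamma (μ.elim 3 Fin.castSucc))

/-- The **mass term** `(m_f + 4) δ` (bare mass plus the `r = 1` Wilson shift `4`), diagonal on the
quark variables. [cite: MontvayMunster1994, §4.2.2 (4.85)–(4.87)] -/
def thermalMassMatrix (mq : Fin Nf → ℝ) :
    Matrix (CircleQuarkVar Nf Nt Ns) (CircleQuarkVar Nf Nt Ns) ℂ :=
  Matrix.diagonal fun v => ((mq v.1 + 4 : ℝ) : ℂ)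

/-- The thermal Wilson–Dirac matrix on the un-enumerated quark variables with the hopping term
scaled by `t ∈ ℝ`: `Λ − (t/2) Σ_μ H_μ` (`t = 1` is `qcdThermalDirac` up to the enumeration,
`qcdThermalDirac_eq_reindex_thermalDiracCore`; `t = 0` is the mass term; on flavour `f` it is
`(m_f + 4)·(1 − K Σ_μ H_μ)` with hopping parameter `K = t/(2m_f + 8)`, i.e. `t` interpolates the
hopping parameter linearly from `0` to Montvay–Münster's `1/(2m_f + 8)` of (4.87)). [folklore] -/
def thermalDiracCore (U : QCDCircleConfig Nt Ns) (mq : Fin Nf → ℝ) (t : ℝ) :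
    Matrix (CircleQuarkVar Nf Nt Ns) (CircleQuarkVar Nf Nt Ns) ℂ :=
  thermalMassMatrix mq - ((t / 2 : ℝ) : ℂ) • ∑ μ : SlabGauge.Dir 3, thermalHopping U μ

/-- `γ₅` on the quark variables: `1_flavour ⊗ (1_{site × colour} ⊗ γ₅)`. [folklore] -/
def thermalGammaFiveCore (Nf Nt Ns : ℕ) [NeZero Nt] [NeZero Ns] :
    Matrix (CircleQuarkVar Nf Nt Ns) (CircleQuarkVar Nf Nt Ns) ℂ :=
  (1 : Matrix (Fin Nf) (Fin Nf) ℂ) ⊗ₖ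
    Matrix.reindex (Equiv.prodAssoc _ _ _) (Equiv.prodAssoc _ _ _)
      ((1 : Matrix (SlabGauge.Site 3 Nt Ns × Fin 3) (SlabGauge.Site 3 Nt Ns × Fin 3) ℂ) ⊗ₖ
        gammaFive)

/-- **`γ₅` on the enumerated quark variables** of `ℤ_{N_t} × (ℤ/N_s)³` — the conjugating matrix of
Montvay–Münster (5.15), acting on the Dirac index only. [cite: MontvayMunster1994, §5.1.2 (5.15)] -/
def thermalGammaFive (Nf Nt Ns : ℕ) [NeZero Nt] [NeZero Ns] :
    Matrix (CircleFermiIdx Nf Nt Ns) (CircleFermiIdx Nf Nt Ns) ℂ :=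
  Matrix.reindex circleQuarkEquiv circleQuarkEquiv (thermalGammaFiveCore Nf Nt Ns)

/-! #### Entries and the decomposition `D = Λ − ½ Σ_μ H_μ` -/

omit [NeZero Nt] [NeZero Ns] in
/-- Entries of the link hopping matrix. [folklore] -/
theorem thermalLinkHop_apply (U : QCDCircleConfig Nt Ns) (μ : SlabGauge.Dir 3)
    (x y : SlabGauge.Site 3 Nt Ns) (a b : Fin 3) :
    thermalLinkHop U μ (x, a) (y, b) =
      if y = x.shift μ then thermalSeamSign μ x * fundamentalRep (Fin 3) (U (x, μ)) a b else 0 :=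
  rfl

omit [NeZero Nt] [NeZero Ns] in
/-- Entries of the adjoint link hopping matrix: the backward hop `s_μ(y) U(y,μ)⁻¹ δ_{x,y+μ̂}`
(`ρ(g)† = ρ(g⁻¹)` for the unitary fundamental representation). [folklore] -/
theorem thermalLinkHop_conjTranspose_apply (U : QCDCircleConfig Nt Ns) (μ : SlabGauge.Dir 3)
    (x y : SlabGauge.Site 3 Nt Ns) (a b : Fin 3) :
    (thermalLinkHop U μ)ᴴ (x, a) (y, b) =
      if x = y.shift μ then thermalSeamSign μ y * fundamentalRep (Fin 3) ((U (y, μ))⁻¹) a b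
      else 0 := by
  rw [conjTranspose_apply, thermalLinkHop_apply]
  split_ifs with h
  · rw [star_mul', star_thermalSeamSign,
      unitaryRep_star_apply (fundamentalRep (Fin 3)) fundamentalRep_mem_unitaryGroup]
  · exact star_zero _

omit [NeZero Nt] [NeZero Ns] in
/-- Entries of the unit hopping matrix: forward hop `s_μ(x) (1 − γ_k)_{αβ} U(x,μ)_{ab} δ_{y,x+μ̂}`
plus backward hop `s_μ(y) (1 + γ_k)_{αβ} (U(y,μ)⁻¹)_{ab} δ_{x,y+μ̂}`, flavour-diagonal. [cite: MontvayMunster1994, §4.2.2 (4.85); §5.1.1 (5.5)] -/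
theorem thermalHopping_apply (U : QCDCircleConfig Nt Ns) (μ : SlabGauge.Dir 3)
    (f g : Fin Nf) (x y : SlabGauge.Site 3 Nt Ns) (a b : Fin 3) (α β : Fin 4) :
    thermalHopping U μ (f, (x, (a, α))) (g, (y, (b, β))) =
      if f = g then
        (if y = x.shift μ then thermalSeamSign μ x * fundamentalRep (Fin 3) (U (x, μ)) a b
            else 0) * oneSubGamma (μ.elim 3 Fin.castSucc) α β +
          (if x = y.shift μ then
              thermalSeamSign μ y * fundamentalRep (Fin 3) ((U (y, μ))⁻¹) a b
            else 0) * oneAddGamma (μ.elim 3 Fin.castSucc) α β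
      else 0 := by
  simp only [thermalHopping, kronecker_apply, reindex_apply, submatrix_apply,
    Equiv.prodAssoc_symm_apply, Matrix.add_apply, thermalLinkHop_apply,
    thermalLinkHop_conjTranspose_apply, one_apply]
  split_ifs <;> simp

omit [NeZero Nt] [NeZero Ns] in
/-- Entries of the mass term. [folklore] -/
theorem thermalMassMatrix_apply (mq : Fin Nf → ℝ) (v w : CircleQuarkVar Nf Nt Ns) :
    thermalMassMatrix mq v w = if v = w then ((mq v.1 + 4 : ℝ) : ℂ) else 0 := by
  rw [thermalMassMatrix, diagonal_apply]

/-- **Structure of the thermal Wilson–Dirac matrix**: `qcdThermalDirac U mq` is the enumeration of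
`Λ − ½ Σ_μ H_μ` (mass term minus half the sum of the four unit hopping matrices). [cite: MontvayMunster1994, §4.2.2 (4.85); §5.1.1 (5.5)] -/
theorem qcdThermalDirac_eq_reindex_thermalDiracCore (U : QCDCircleConfig Nt Ns)
    (mq : Fin Nf → ℝ) :
    qcdThermalDirac U mq =
      Matrix.reindex circleQuarkEquiv circleQuarkEquiv (thermalDiracCore U mq 1) := by
  unfold qcdThermalDirac thermalDiracCore
  congr 1
  ext ⟨f, x, a, α⟩ ⟨g, y, b, β⟩
  rw [of_apply, Matrix.sub_apply, Matrix.smul_apply, Matrix.sum_apply, thermalMassMatrix_apply]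
  have h2 : ((1 / 2 : ℝ) : ℂ) = 2⁻¹ := by norm_num
  simp only [thermalHopping_apply, h2, smul_eq_mul, Prod.mk.injEq]
  by_cases hfg : f = g
  · subst hfg
    simp only [true_and, if_true]
    congr 1
    refine congrArg _ (Finset.sum_congr rfl fun μ _ => ?_)
    split_ifs <;> ring
  · simp [hfg]

end Structure

/-! ### γ₅-hermiticity (Montvay–Münster (5.15)) and reality of the determinant ((5.16)) -/

section GammaFive

variable [NeZero Nt] [NeZero Ns]

omit [NeZero Nt] [NeZero Ns] in
/-- `H_μ† = 1 ⊗ (V_μ† ⊗ (1 − γ_k) + V_μ ⊗ (1 + γ_k))`. [folklore] -/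
theorem conjTranspose_thermalHopping (U : QCDCircleConfig Nt Ns) (μ : SlabGauge.Dir 3) :
    (thermalHopping (Nf := Nf) U μ)ᴴ =
      (1 : Matrix (Fin Nf) (Fin Nf) ℂ) ⊗ₖ
        Matrix.reindex (Equiv.prodAssoc _ _ _) (Equiv.prodAssoc _ _ _)
          ((thermalLinkHop U μ)ᴴ ⊗ₖ oneSubGamma (μ.elim 3 Fin.castSucc) +
            thermalLinkHop U μ ⊗ₖ oneAddGamma (μ.elim 3 Fin.castSucc)) := by
  rw [thermalHopping, conjTranspose_kronecker, conjTranspose_one, conjTranspose_reindex,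
    conjTranspose_add, conjTranspose_kronecker, conjTranspose_kronecker,
    conjTranspose_conjTranspose, conjTranspose_oneSubGamma, conjTranspose_oneAddGamma]

/-- `γ₅ H_μ γ₅ = H_μ†`: the unit hopping matrices are γ₅-Hermitian (γ₅ exchanges `1 ∓ γ_k`,
the adjoint exchanges `V_μ` and `V_μ†`). [cite: MontvayMunster1994, §5.1.2 (5.15)] -/
theorem thermalGammaFiveCore_mul_thermalHopping_mul (U : QCDCircleConfig Nt Ns)
    (μ : SlabGauge.Dir 3) :
    thermalGammaFiveCore Nf Nt Ns * thermalHopping U μ * thermalGammaFiveCore Nf Nt Ns =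
      (thermalHopping U μ)ᴴ := by
  rw [conjTranspose_thermalHopping, thermalGammaFiveCore, thermalHopping, ← mul_kronecker_mul,
    ← mul_kronecker_mul, one_mul, one_mul, reindex_mul_reindex, reindex_mul_reindex, mul_add,
    add_mul, ← mul_kronecker_mul, ← mul_kronecker_mul, ← mul_kronecker_mul,
    ← mul_kronecker_mul, one_mul, one_mul, mul_one, mul_one, gammaFive_mul_oneSubGamma_mul_gammaFive,
    gammaFive_mul_oneAddGamma_mul_gammaFive, add_comm (thermalLinkHop U μ ⊗ₖ _)]

omit [NeZero Nt] [NeZero Ns] in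
/-- The mass term is Hermitian (real diagonal). [folklore] -/
theorem conjTranspose_thermalMassMatrix (mq : Fin Nf → ℝ) :
    (thermalMassMatrix (Nt := Nt) (Ns := Ns) mq)ᴴ = thermalMassMatrix mq := by
  rw [thermalMassMatrix, diagonal_conjTranspose]
  congr 1
  funext v
  exact Complex.conj_ofReal _

/-- `γ₅` on the quark variables is the diagonal sign matrix `ε_{spin}`, `ε = (1, 1, −1, −1)`
(chiral basis). [folklore] -/
theorem thermalGammaFiveCore_eq_diagonal :
    thermalGammaFiveCore Nf Nt Ns =
      diagonal fun v : CircleQuarkVar Nf Nt Ns => (![1, 1, -1, -1] : Fin 4 → ℂ) v.2.2.2 := by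
  have h1 :
      (1 : Matrix (SlabGauge.Site 3 Nt Ns × Fin 3) (SlabGauge.Site 3 Nt Ns × Fin 3) ℂ) ⊗ₖ
        gammaFive = diagonal fun p => (![1, 1, -1, -1] : Fin 4 → ℂ) p.2 := by
    rw [gammaFive_eq_diagonal, ← diagonal_one, diagonal_kronecker_diagonal]
    simp
  rw [thermalGammaFiveCore, h1, reindex_apply, submatrix_diagonal_equiv, ← diagonal_one,
    diagonal_kronecker_diagonal]
  congr 1
  funext ⟨f, x, a, α⟩
  simp

/-- `γ₅² = 1` on the quark variables. [folklore] -/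
theorem thermalGammaFiveCore_mul_self :
    thermalGammaFiveCore Nf Nt Ns * thermalGammaFiveCore Nf Nt Ns = 1 := by
  rw [thermalGammaFiveCore_eq_diagonal, diagonal_mul_diagonal, ← diagonal_one]
  congr 1
  funext v
  exact gammaFiveSign_mul_self _

/-- `γ₅ Λ γ₅ = Λ` (both diagonal, `γ₅² = 1`). [folklore] -/
theorem thermalGammaFiveCore_mul_thermalMassMatrix_mul (mq : Fin Nf → ℝ) :
    thermalGammaFiveCore Nf Nt Ns * thermalMassMatrix mq * thermalGammaFiveCore Nf Nt Ns =
      thermalMassMatrix mq := by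
  rw [thermalGammaFiveCore_eq_diagonal, thermalMassMatrix, diagonal_mul_diagonal,
    diagonal_mul_diagonal]
  congr 1
  funext v
  rw [mul_right_comm, gammaFiveSign_mul_self, one_mul]

/-- **γ₅-hermiticity of the whole hopping family**: `(Λ − (t/2) Σ H_μ)† = γ₅ (Λ − (t/2) Σ H_μ) γ₅`
for real `t`. [cite: MontvayMunster1994, §5.1.2 (5.15)] -/
theorem conjTranspose_thermalDiracCore (U : QCDCircleConfig Nt Ns) (mq : Fin Nf → ℝ) (t : ℝ) :
    (thermalDiracCore U mq t)ᴴ =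
      thermalGammaFiveCore Nf Nt Ns * thermalDiracCore U mq t * thermalGammaFiveCore Nf Nt Ns := by
  have hc : star ((t / 2 : ℝ) : ℂ) = ((t / 2 : ℝ) : ℂ) := Complex.conj_ofReal _
  rw [thermalDiracCore, conjTranspose_sub, conjTranspose_smul, conjTranspose_sum,
    conjTranspose_thermalMassMatrix, hc, mul_sub, sub_mul, Matrix.mul_smul, Matrix.smul_mul,
    Finset.mul_sum, Finset.sum_mul, thermalGammaFiveCore_mul_thermalMassMatrix_mul]
  congr 2
  exact Finset.sum_congr rfl fun μ _ => (thermalGammaFiveCore_mul_thermalHopping_mul U μ).symm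

/-- The determinant of the hopping family is real for real `t`. [cite: MontvayMunster1994, §5.1.2 (5.16)] -/
theorem det_thermalDiracCore_im (U : QCDCircleConfig Nt Ns) (mq : Fin Nf → ℝ) (t : ℝ) :
    ((thermalDiracCore U mq t).det).im = 0 := by
  have hΓ := conjTranspose_thermalDiracCore U mq t
  have hdet : star (thermalDiracCore U mq t).det = (thermalDiracCore U mq t).det := by
    rw [← det_conjTranspose, hΓ, det_mul, det_mul,
      mul_comm (det _) (det (thermalDiracCore U mq t)), mul_assoc, ← det_mul,
      thermalGammaFiveCore_mul_self, det_one, mul_one]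
  exact Complex.conj_eq_iff_im.1 hdet

/-- **γ₅-hermiticity of the thermal Wilson–Dirac matrix** (Montvay–Münster (5.15),
"`Q_{yx} = γ₅ Q†_{xy} γ₅`", for the time-antiperiodic matrix: the seam signs are real and sit
symmetrically on the two hops through each seam link): `D† = γ₅ D γ₅`. [cite: MontvayMunster1994, §5.1.2 (5.15)] -/
theorem qcdThermalDirac_conjTranspose (U : QCDCircleConfig Nt Ns) (mq : Fin Nf → ℝ) :
    (qcdThermalDirac U mq)ᴴ =
      thermalGammaFive Nf Nt Ns * qcdThermalDirac U mq * thermalGammaFive Nf Nt Ns := by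
  rw [qcdThermalDirac_eq_reindex_thermalDiracCore, thermalGammaFive, conjTranspose_reindex,
    conjTranspose_thermalDiracCore, reindex_mul_reindex, reindex_mul_reindex]

/-- `γ₅² = 1`. [folklore] -/
theorem thermalGammaFive_mul_self : thermalGammaFive Nf Nt Ns * thermalGammaFive Nf Nt Ns = 1 := by
  rw [thermalGammaFive, reindex_mul_reindex, thermalGammaFiveCore_mul_self, reindex_one_eq]

/-- **The thermal Wilson determinant is real** (Montvay–Münster (5.16): "Therefore the quark
determinant is real, because `det Q = det Q⁺ = (det Q)^*`"), for every gauge field, all real bare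
masses, every `N_f`, on `ℤ_{N_t} × (ℤ/N_s)³` with antiperiodic time. [cite: MontvayMunster1994, §5.1.2 (5.16)] -/
theorem det_qcdThermalDirac_im (U : QCDCircleConfig Nt Ns) (mq : Fin Nf → ℝ) :
    ((qcdThermalDirac U mq).det).im = 0 := by
  rw [qcdThermalDirac_eq_reindex_thermalDiracCore, det_reindex_self]
  exact det_thermalDiracCore_im U mq 1

/-- The thermal Wilson determinant equals its real part. [cite: MontvayMunster1994, §5.1.2 (5.16)] -/
theorem det_qcdThermalDirac_eq_ofReal (U : QCDCircleConfig Nt Ns) (mq : Fin Nf → ℝ) :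
    (qcdThermalDirac U mq).det = (((qcdThermalDirac U mq).det.re : ℝ) : ℂ) :=
  Complex.ext rfl (by rw [Complex.ofReal_im]; exact det_qcdThermalDirac_im U mq)

end GammaFive

/-! ### The partition function is real -/

/-- **`Z = ∫ Re det D(U) · e^{β Σ Re tr U_P} ∏dU` as a real integral**: the thermal partition
function is the (real) Haar integral of the real Wilson determinant against the Wilson weight. [cite: MontvayMunster1994, §5.1.2 (5.16)–(5.19)] -/
theorem qcdThermalPartition_eq_ofReal_integral (Nf Nt Ns : ℕ) [NeZero Nt] [NeZero Ns] (β : ℝ)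
    (mq : Fin Nf → ℝ) :
    qcdThermalPartition Nf Nt Ns β mq =
      ((∫ U, (qcdThermalDirac U mq).det.re * SlabGauge.weight (fundamentalRep (Fin 3)) β β U
          ∂(SlabGauge.haar 3 Nt Ns (Matrix.specialUnitaryGroup (Fin 3) ℂ)) : ℝ) : ℂ) := by
  rw [qcdThermalPartition_eq_integral_det, ← integral_complex_ofReal]
  refine integral_congr_ae (Filter.Eventually.of_forall fun U => ?_)
  exact (congrArg (· * ((SlabGauge.weight (fundamentalRep (Fin 3)) β β U : ℝ) : ℂ))
    (det_qcdThermalDirac_eq_ofReal U mq)).trans (Complex.ofReal_mul _ _).symm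

/-- **The thermal partition function of lattice QCD is real** (all `β`, all real bare masses,
every `N_f`, `N_t`, `N_s`). [cite: MontvayMunster1994, §5.1.2 (5.16)–(5.19)] -/
theorem qcdThermalPartition_im (Nf Nt Ns : ℕ) [NeZero Nt] [NeZero Ns] (β : ℝ)
    (mq : Fin Nf → ℝ) :
    (qcdThermalPartition Nf Nt Ns β mq).im = 0 := by
  rw [qcdThermalPartition_eq_ofReal_integral, Complex.ofReal_im]

/-- The free energy per site only sees `|Re Z|`: `f = −log |Re Z| / (N_t N_s³)`. [folklore] -/
theorem thermalFreeEnergyDensity_eq_neg_log_abs_re (Nf Nt Ns : ℕ) [NeZero Nt] [NeZero Ns]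
    (β : ℝ) (mq : Fin Nf → ℝ) :
    thermalFreeEnergyDensity Nf Nt Ns β mq =
      -Real.log |(qcdThermalPartition Nf Nt Ns β mq).re| / ((Nt : ℝ) * (Ns : ℝ) ^ 3) := by
  rw [thermalFreeEnergyDensity, qcdThermalPartition_eq_ofReal_integral, Complex.norm_real,
    Complex.ofReal_re, Real.norm_eq_abs]

/-! ### Heavy-quark positivity: `det D(U) > 0` for all `m_f > 0` (`K_f < 1/8`), hence `Z > 0` -/

section Positivity

variable [NeZero Nt] [NeZero Ns]

/-! #### The link hopping matrices are unitary and `H_μ† H_μ = 4` -/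

/-- `V_μ V_μ† = 1`: the signed link hopping matrix is unitary. [folklore] -/
theorem thermalLinkHop_mul_conjTranspose (U : QCDCircleConfig Nt Ns) (μ : SlabGauge.Dir 3) :
    thermalLinkHop U μ * (thermalLinkHop U μ)ᴴ = 1 := by
  ext ⟨x, a⟩ ⟨z, c⟩
  rw [mul_apply, Fintype.sum_prod_type, one_apply,
    Finset.sum_eq_single_of_mem (x.shift μ) (Finset.mem_univ _)]
  · simp only [thermalLinkHop_apply, thermalLinkHop_conjTranspose_apply, if_true, Prod.mk.injEq]
    by_cases hxz : x = z
    · subst hxz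
      simp only [if_true, true_and]
      have h1 :
          fundamentalRep (Fin 3) (U (x, μ)) * fundamentalRep (Fin 3) ((U (x, μ))⁻¹) = 1 := by
        rw [← map_mul, mul_inv_cancel, map_one]
      have h2 := congrFun (congrFun h1 a) c
      rw [mul_apply, one_apply] at h2
      rw [← h2]
      refine Finset.sum_congr rfl fun b _ => ?_
      calc thermalSeamSign μ x * fundamentalRep (Fin 3) (U (x, μ)) a b *
            (thermalSeamSign μ x * fundamentalRep (Fin 3) ((U (x, μ))⁻¹) b c)
          = (thermalSeamSign μ x * thermalSeamSign μ x) *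
              (fundamentalRep (Fin 3) (U (x, μ)) a b *
                fundamentalRep (Fin 3) ((U (x, μ))⁻¹) b c) := by
            ring
        _ = _ := by rw [thermalSeamSign_mul_self, one_mul]
    · have hne : x.shift μ ≠ z.shift μ := fun h => hxz (SlabGauge.shift_injective μ h)
      simp [hne, hxz]
  · intro y _ hy
    simp [thermalLinkHop_apply, hy]

/-- `V_μ† V_μ = 1`. [folklore] -/
theorem conjTranspose_mul_thermalLinkHop (U : QCDCircleConfig Nt Ns) (μ : SlabGauge.Dir 3) :
    (thermalLinkHop U μ)ᴴ * thermalLinkHop U μ = 1 :=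
  mul_eq_one_comm.1 (thermalLinkHop_mul_conjTranspose U μ)

/-- **`H_μ† H_μ = 4`**: half the unit hopping matrix, `½H_μ = 1 ⊗ (V_μ ⊗ P⁻_k + V_μ† ⊗ P⁺_k)`, is
unitary (`P^∓_k = (1 ∓ γ_k)/2` complementary orthogonal projections, `V_μ` unitary). [folklore] -/
theorem conjTranspose_mul_thermalHopping (U : QCDCircleConfig Nt Ns) (μ : SlabGauge.Dir 3) :
    (thermalHopping (Nf := Nf) U μ)ᴴ * thermalHopping U μ = (4 : ℂ) • 1 := by
  rw [conjTranspose_thermalHopping, thermalHopping, ← mul_kronecker_mul, one_mul,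
    reindex_mul_reindex, add_mul, mul_add, mul_add, ← mul_kronecker_mul, ← mul_kronecker_mul,
    ← mul_kronecker_mul, ← mul_kronecker_mul, conjTranspose_mul_thermalLinkHop,
    thermalLinkHop_mul_conjTranspose, oneSubGamma_mul_oneSubGamma, oneSubGamma_mul_oneAddGamma,
    oneAddGamma_mul_oneSubGamma, oneAddGamma_mul_oneAddGamma, kronecker_zero, kronecker_zero,
    add_zero, zero_add, kronecker_smul, kronecker_smul, ← smul_add, ← kronecker_add,
    oneSubGamma_add_oneAddGamma,
    kronecker_smul, one_kronecker_one, smul_smul, reindex_smul_eq, reindex_one_eq, kronecker_smul,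
    one_kronecker_one]
  norm_num

/-- `Σ_v |x_v|²` as the self-pairing `x̄ · x`. [folklore] -/
theorem star_dotProduct_self_eq {ι : Type*} [Fintype ι] (x : ι → ℂ) :
    star x ⬝ᵥ x = ((∑ i, ‖x i‖ ^ 2 : ℝ) : ℂ) := by
  simp only [dotProduct, Pi.star_apply, Complex.star_def, Complex.conj_mul', Complex.ofReal_sum,
    Complex.ofReal_pow]

/-- **`‖H_μ x‖² = 4‖x‖²`** for every vector of quark amplitudes. [folklore] -/
theorem normSq_thermalHopping_mulVec (U : QCDCircleConfig Nt Ns) (μ : SlabGauge.Dir 3)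
    (x : CircleQuarkVar Nf Nt Ns → ℂ) :
    ∑ v, ‖(thermalHopping U μ *ᵥ x) v‖ ^ 2 = 4 * ∑ v, ‖x v‖ ^ 2 := by
  have h : star (thermalHopping U μ *ᵥ x) ⬝ᵥ (thermalHopping U μ *ᵥ x) =
      4 * (star x ⬝ᵥ x) := by
    rw [star_mulVec, dotProduct_mulVec, vecMul_vecMul, conjTranspose_mul_thermalHopping,
      vecMul_smul, vecMul_one, smul_dotProduct, smul_eq_mul]
  rw [star_dotProduct_self_eq, star_dotProduct_self_eq] at h
  exact_mod_cast h

/-! #### No kernel for `m_f > 0` along the whole hopping homotopy `t ∈ [0, 1]` -/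

/-- `(Λ x)_v = (m_f + 4) x_v`. [folklore] -/
theorem thermalMassMatrix_mulVec_apply (mq : Fin Nf → ℝ) (x : CircleQuarkVar Nf Nt Ns → ℂ)
    (v : CircleQuarkVar Nf Nt Ns) :
    (thermalMassMatrix mq *ᵥ x) v = ((mq v.1 + 4 : ℝ) : ℂ) * x v := by
  rw [thermalMassMatrix, mulVec_diagonal]

/-- **Kernel-freeness** (the hopping-parameter bound `K < 1/8`): if all bare masses are positive,
`(Λ − (t/2) Σ_μ H_μ) x = 0` forces `x = 0` for every `t ∈ [0, 1]` and every gauge field, since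
`‖(t/2) Σ_μ H_μ x‖ ≤ 4‖x‖ < min_f (m_f + 4) ‖x‖ ≤ ‖Λ x‖`. [folklore] -/
theorem eq_zero_of_thermalDiracCore_mulVec_eq_zero (U : QCDCircleConfig Nt Ns) {mq : Fin Nf → ℝ}
    (hm : ∀ f, 0 < mq f) {t : ℝ} (ht0 : 0 ≤ t) (ht1 : t ≤ 1) {x : CircleQuarkVar Nf Nt Ns → ℂ}
    (hx : thermalDiracCore U mq t *ᵥ x = 0) : x = 0 := by
  have hX0 : 0 ≤ ∑ v, ‖x v‖ ^ 2 := Finset.sum_nonneg fun v _ => sq_nonneg _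
  -- the kernel equation: `Λ x = (t/2) Σ_μ H_μ x`
  have hΛ : thermalMassMatrix mq *ᵥ x = ((t / 2 : ℝ) : ℂ) • ∑ μ, thermalHopping U μ *ᵥ x := by
    have h := hx
    rw [thermalDiracCore, sub_mulVec, smul_mulVec, sum_mulVec, sub_eq_zero] at h
    exact h
  -- `‖Λ x‖² = Σ (m_f + 4)² |x_v|²`
  have hL : ∑ v, ‖(thermalMassMatrix mq *ᵥ x) v‖ ^ 2 = ∑ v, (mq v.1 + 4) ^ 2 * ‖x v‖ ^ 2 := by
    refine Finset.sum_congr rfl fun v _ => ?_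
    rw [thermalMassMatrix_mulVec_apply, norm_mul, mul_pow, Complex.norm_real, Real.norm_eq_abs,
      sq_abs]
  -- `‖(t/2) Σ_μ H_μ x‖² ≤ 16 t² X ≤ 16 X`
  have hsum : ∀ v, ‖(∑ μ, thermalHopping U μ *ᵥ x) v‖ ^ 2 ≤
      4 * ∑ μ, ‖(thermalHopping U μ *ᵥ x) v‖ ^ 2 := fun v => by
    rw [Finset.sum_apply]
    calc ‖∑ μ, (thermalHopping U μ *ᵥ x) v‖ ^ 2
        ≤ (∑ μ, ‖(thermalHopping U μ *ᵥ x) v‖) ^ 2 := by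
          gcongr
          exact norm_sum_le _ _
      _ ≤ (Finset.univ : Finset (SlabGauge.Dir 3)).card *
            ∑ μ, ‖(thermalHopping U μ *ᵥ x) v‖ ^ 2 := sq_sum_le_card_mul_sum_sq
      _ = 4 * ∑ μ, ‖(thermalHopping U μ *ᵥ x) v‖ ^ 2 := by
          rw [Finset.card_univ]
          norm_num [Fintype.card_option]
  have hR : ∑ v, ‖(((t / 2 : ℝ) : ℂ) • ∑ μ, thermalHopping U μ *ᵥ x) v‖ ^ 2 ≤
      16 * ∑ v, ‖x v‖ ^ 2 := by
    calc ∑ v, ‖(((t / 2 : ℝ) : ℂ) • ∑ μ, thermalHopping U μ *ᵥ x) v‖ ^ 2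
        = (t / 2) ^ 2 * ∑ v, ‖(∑ μ, thermalHopping U μ *ᵥ x) v‖ ^ 2 := by
          rw [Finset.mul_sum]
          refine Finset.sum_congr rfl fun v _ => ?_
          rw [Pi.smul_apply, smul_eq_mul, norm_mul, mul_pow, Complex.norm_real, Real.norm_eq_abs,
            sq_abs]
      _ ≤ (t / 2) ^ 2 * ∑ v, (4 * ∑ μ, ‖(thermalHopping U μ *ᵥ x) v‖ ^ 2) := by
          gcongr with v
          exact hsum v
      _ = (t / 2) ^ 2 * (4 * ∑ μ : SlabGauge.Dir 3, ∑ v, ‖(thermalHopping U μ *ᵥ x) v‖ ^ 2) := by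
          rw [← Finset.mul_sum, Finset.sum_comm]
      _ = (t / 2) ^ 2 * (4 * ∑ _μ : SlabGauge.Dir 3, 4 * ∑ v, ‖x v‖ ^ 2) := by
          simp_rw [normSq_thermalHopping_mulVec]
      _ = 16 * t ^ 2 * ∑ v, ‖x v‖ ^ 2 := by
          rw [Finset.sum_const, Finset.card_univ, nsmul_eq_mul]
          norm_num [Fintype.card_option]
          ring
      _ ≤ 16 * 1 * ∑ v, ‖x v‖ ^ 2 := by
          gcongr
          nlinarith
      _ = 16 * ∑ v, ‖x v‖ ^ 2 := by ring
  -- but `Σ (m_f + 4)² |x_v|² > 16 X` unless `x = 0`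
  by_contra hx0
  have hex : ∃ v, x v ≠ 0 := by
    by_contra h
    push Not at h
    exact hx0 (funext h)
  have hlt : 16 * ∑ v, ‖x v‖ ^ 2 < ∑ v, (mq v.1 + 4) ^ 2 * ‖x v‖ ^ 2 := by
    rw [Finset.mul_sum]
    apply Finset.sum_lt_sum
    · intro v _
      exact mul_le_mul_of_nonneg_right (by nlinarith [hm v.1]) (sq_nonneg _)
    · obtain ⟨v, hv⟩ := hex
      exact ⟨v, Finset.mem_univ _,
        mul_lt_mul_of_pos_right (by nlinarith [hm v.1]) (by positivity)⟩
  have hle : ∑ v, (mq v.1 + 4) ^ 2 * ‖x v‖ ^ 2 ≤ 16 * ∑ v, ‖x v‖ ^ 2 := by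
    rw [← hL, hΛ]
    exact hR
  linarith

/-- **`det (Λ − (t/2) Σ_μ H_μ) ≠ 0`** for `m_f > 0`, `t ∈ [0, 1]`, every gauge field. [folklore] -/
theorem det_thermalDiracCore_ne_zero (U : QCDCircleConfig Nt Ns) {mq : Fin Nf → ℝ}
    (hm : ∀ f, 0 < mq f) {t : ℝ} (ht0 : 0 ≤ t) (ht1 : t ≤ 1) :
    (thermalDiracCore U mq t).det ≠ 0 := by
  intro hdet
  obtain ⟨v, hv0, hv⟩ := Matrix.exists_mulVec_eq_zero_iff.2 hdet
  exact hv0 (eq_zero_of_thermalDiracCore_mulVec_eq_zero U hm ht0 ht1 hv)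

/-! #### The sign: continuity in the hopping strength and the value at `t = 0` -/

omit [NeZero Nt] [NeZero Ns] in
/-- At hopping strength `t = 0` only the mass term remains. [folklore] -/
theorem thermalDiracCore_zero (U : QCDCircleConfig Nt Ns) (mq : Fin Nf → ℝ) :
    thermalDiracCore U mq 0 = thermalMassMatrix mq := by
  simp [thermalDiracCore]

/-- `det Λ = ∏_v (m_{f(v)} + 4)`, a real number. [folklore] -/
theorem det_thermalMassMatrix (mq : Fin Nf → ℝ) :
    (thermalMassMatrix (Nt := Nt) (Ns := Ns) mq).det =
      ((∏ v : CircleQuarkVar Nf Nt Ns, (mq v.1 + 4) : ℝ) : ℂ) := by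
  rw [thermalMassMatrix, det_diagonal, Complex.ofReal_prod]

/-- `t ↦ det (Λ − (t/2) Σ_μ H_μ)` is continuous (a polynomial in `t`). [folklore] -/
theorem continuous_det_thermalDiracCore (U : QCDCircleConfig Nt Ns) (mq : Fin Nf → ℝ) :
    Continuous fun t : ℝ => (thermalDiracCore U mq t).det := by
  refine Continuous.matrix_det ?_
  unfold thermalDiracCore
  exact continuous_const.sub
    ((Complex.continuous_ofReal.comp (continuous_id.div_const 2)).smul continuous_const)

/-- **Positivity of the determinant along the homotopy**: for `m_f > 0` and `t ∈ [0, 1]`,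
`Re det (Λ − (t/2) Σ_μ H_μ) > 0` — the determinant is real (`γ₅`), never zero on `[0, t]`
(kernel-freeness), positive at `t = 0` (`∏ (m_f + 4)`), hence positive by the intermediate value
theorem. [folklore] -/
theorem det_thermalDiracCore_re_pos (U : QCDCircleConfig Nt Ns) {mq : Fin Nf → ℝ}
    (hm : ∀ f, 0 < mq f) {t : ℝ} (ht0 : 0 ≤ t) (ht1 : t ≤ 1) :
    0 < ((thermalDiracCore U mq t).det).re := by
  set g : ℝ → ℝ := fun s => ((thermalDiracCore U mq s).det).re with hg
  have hcont : Continuous g := Complex.continuous_re.comp (continuous_det_thermalDiracCore U mq)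
  have h0 : 0 < g 0 := by
    simp only [hg, thermalDiracCore_zero, det_thermalMassMatrix, Complex.ofReal_re]
    exact Finset.prod_pos fun v _ => by linarith [hm v.1]
  by_contra hle
  push Not at hle
  obtain ⟨s, ⟨hs0, hst⟩, hs⟩ :=
    intermediate_value_Icc' ht0 hcont.continuousOn ⟨hle, h0.le⟩
  have hzero : (thermalDiracCore U mq s).det = 0 :=
    Complex.ext hs (det_thermalDiracCore_im U mq s)
  exact det_thermalDiracCore_ne_zero U hm hs0 (hst.trans ht1) hzero

/-- **The thermal Wilson determinant is positive for positive bare masses**: for every `SU(3)`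
gauge field `U` on `ℤ_{N_t} × (ℤ/N_s)³`, every `N_f` and all `m_f > 0` (hopping parameters
`K_f = 1/(2m_f + 8) < 1/8`), `det D(U) > 0` (real by (5.16)). [folklore] -/
theorem det_qcdThermalDirac_re_pos (U : QCDCircleConfig Nt Ns) {mq : Fin Nf → ℝ}
    (hm : ∀ f, 0 < mq f) : 0 < ((qcdThermalDirac U mq).det).re := by
  rw [qcdThermalDirac_eq_reindex_thermalDiracCore, det_reindex_self]
  exact det_thermalDiracCore_re_pos U hm zero_le_one le_rfl

/-! #### `Z > 0` and the free energy -/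

omit [NeZero Nt] [NeZero Ns] in
/-- Link matrix entries depend continuously on the gauge field. [folklore] -/
theorem continuous_link_rep (e : SlabGauge.Site 3 Nt Ns × SlabGauge.Dir 3) (a b : Fin 3) :
    Continuous fun U : QCDCircleConfig Nt Ns => fundamentalRep (Fin 3) (U e) a b :=
  ((continuous_fundamentalRep (Fin 3)).comp (continuous_apply e)).matrix_elem a b

omit [NeZero Nt] [NeZero Ns] in
/-- Inverse link matrix entries depend continuously on the gauge field. [folklore] -/
theorem continuous_link_inv_rep (e : SlabGauge.Site 3 Nt Ns × SlabGauge.Dir 3) (a b : Fin 3) :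
    Continuous fun U : QCDCircleConfig Nt Ns => fundamentalRep (Fin 3) ((U e)⁻¹) a b :=
  ((continuous_fundamentalRep (Fin 3)).comp ((continuous_apply e).inv)).matrix_elem a b

/-- The thermal Wilson–Dirac matrix depends continuously on the gauge field. [folklore] -/
theorem continuous_qcdThermalDirac (mq : Fin Nf → ℝ) :
    Continuous fun U : QCDCircleConfig Nt Ns => qcdThermalDirac U mq := by
  refine continuous_matrix fun p q => ?_
  obtain ⟨⟨f, x, a, α⟩, rfl⟩ := circleQuarkEquiv.surjective p
  obtain ⟨⟨g, y, b, β⟩, rfl⟩ := circleQuarkEquiv.surjective q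
  simp only [qcdThermalDirac, reindex_apply, submatrix_apply, of_apply, Equiv.symm_apply_apply]
  by_cases hfg : f = g
  · simp only [if_pos hfg]
    refine continuous_const.sub (continuous_const.mul (continuous_finsetSum _ fun μ _ => ?_))
    refine Continuous.add ?_ ?_
    · by_cases h : y = x.shift μ
      · simp only [if_pos h]
        exact continuous_const.mul (continuous_const.mul (continuous_link_rep _ _ _))
      · simp only [if_neg h]
        exact continuous_const
    · by_cases h : x = y.shift μ
      · simp only [if_pos h]
        exact continuous_const.mul (continuous_const.mul (continuous_link_inv_rep _ _ _))
      · simp only [if_neg h]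
        exact continuous_const
  · simp only [if_neg hfg]
    exact continuous_const

/-- **`Z > 0` for positive bare masses**: the thermal partition function of lattice QCD on
`ℤ_{N_t} × (ℤ/N_s)³` with `N_f` time-antiperiodic Wilson quarks of bare masses `m_f > 0`
(`K_f < 1/8`) is a positive real number, for every real `β` and all `N_t, N_s ≥ 1` — the integrand
`det D(U) e^{β Σ Re tr U_P}` being positive for EVERY gauge field. (Lüscher's transfer-matrix
positivity extends `Z > 0` to `m_f > −1`, `K_f < 1/6`, for `β ≥ 0`, where `det D(U)` is no longer
pointwise positive; not formalised here.) [folklore] -/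
theorem qcdThermalPartition_re_pos (Nf Nt Ns : ℕ) [NeZero Nt] [NeZero Ns] (β : ℝ)
    {mq : Fin Nf → ℝ} (hm : ∀ f, 0 < mq f) :
    0 < (qcdThermalPartition Nf Nt Ns β mq).re := by
  rw [qcdThermalPartition_eq_ofReal_integral, Complex.ofReal_re]
  have hw : Continuous fun U : QCDCircleConfig Nt Ns =>
      SlabGauge.weight (fundamentalRep (Fin 3)) β β U :=
    SlabGauge.continuous_weight _ (continuous_fundamentalRep (Fin 3)) β β
  have hd : Continuous fun U : QCDCircleConfig Nt Ns => ((qcdThermalDirac U mq).det).re :=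
    Complex.continuous_re.comp (continuous_qcdThermalDirac mq).matrix_det
  have hposU : ∀ U : QCDCircleConfig Nt Ns,
      0 < ((qcdThermalDirac U mq).det).re * SlabGauge.weight (fundamentalRep (Fin 3)) β β U :=
    fun U => mul_pos (det_qcdThermalDirac_re_pos U hm) (SlabGauge.weight_pos _ β β U)
  rw [integral_pos_iff_support_of_nonneg (fun U => (hposU U).le)
    (SlabGauge.integrable_of_continuous (hd.mul hw))]
  have hsupp : Function.support (fun U : QCDCircleConfig Nt Ns =>
      ((qcdThermalDirac U mq).det).re * SlabGauge.weight (fundamentalRep (Fin 3)) β β U) =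
      Set.univ :=
    Set.eq_univ_iff_forall.2 fun U => (hposU U).ne'
  rw [hsupp, measure_univ]
  exact one_pos

/-- `Z` is a positive real number for positive bare masses. [folklore] -/
theorem qcdThermalPartition_pos (Nf Nt Ns : ℕ) [NeZero Nt] [NeZero Ns] (β : ℝ)
    {mq : Fin Nf → ℝ} (hm : ∀ f, 0 < mq f) :
    0 < (qcdThermalPartition Nf Nt Ns β mq).re ∧ (qcdThermalPartition Nf Nt Ns β mq).im = 0 :=
  ⟨qcdThermalPartition_re_pos Nf Nt Ns β hm, qcdThermalPartition_im Nf Nt Ns β mq⟩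

/-- `Z ≠ 0` for positive bare masses (so thermal expectations `Z(X)/Z(1)` are genuine ratios and
`log Z` is the genuine logarithm). [folklore] -/
theorem qcdThermalPartition_ne_zero (Nf Nt Ns : ℕ) [NeZero Nt] [NeZero Ns] (β : ℝ)
    {mq : Fin Nf → ℝ} (hm : ∀ f, 0 < mq f) : qcdThermalPartition Nf Nt Ns β mq ≠ 0 := fun h =>
  (qcdThermalPartition_re_pos Nf Nt Ns β hm).ne' (by rw [h, Complex.zero_re])

/-- **The free energy per site is `−ln Z/(N_t N_s³)` with the genuine logarithm of the positive
partition function**, for positive bare masses (Montvay–Münster (5.246) at `a = 1`). [cite: MontvayMunster1994, §5.4.1 (5.246)] -/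
theorem thermalFreeEnergyDensity_eq_neg_log_re (Nf Nt Ns : ℕ) [NeZero Nt] [NeZero Ns] (β : ℝ)
    {mq : Fin Nf → ℝ} (hm : ∀ f, 0 < mq f) :
    thermalFreeEnergyDensity Nf Nt Ns β mq =
      -Real.log (qcdThermalPartition Nf Nt Ns β mq).re / ((Nt : ℝ) * (Ns : ℝ) ^ 3) := by
  rw [thermalFreeEnergyDensity_eq_neg_log_abs_re,
    abs_of_pos (qcdThermalPartition_re_pos Nf Nt Ns β hm)]

end Positivity

end Literature.MathematicalPhysics.QuantumFieldTheory

end
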